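import Mathlib
import Summits.CriticalPhenomena.CardyFormulaZ2.Theorems.CardyMagicRigidityPositiveConeDefs
import Summits.CriticalPhenomena.CardyFormulaZ2.Theorems.CardyMagicRigidityNestingRigiditySoftMachineLimit
import Summits.CriticalPhenomena.CardyFormulaZ2.Theorems.CardyMagicRigidityNestingRigiditySoftMachineBondWindows
import Summits.CriticalPhenomena.CardyFormulaZ2.Theorems.CardyMagicRigidityNestingRigiditySoftMachineMeasurableAll
import Summits.CriticalPhenomena.CardyFormulaZ2.Theorems.CardyMagicRigidityNestingRigiditySoftMachineSite
import Summits.CriticalPhenomena.CardyFormulaZ2.Theorems.CardyMagicRigidityNestingRigidityPrecompactnessFullSequence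
import HarnessLib

/-!
# Soft machine, brick 11: T1m for `zEns` CONDITIONAL on the bond multiple-traversal estimate

Crux `Summit.CriticalPhenomena.CardyFormulaZ2.Theses.CardyMagicRigidity.NestingRigidity`
(stmt-CriticalPhenomena-4835), line `positive-cone-weight-doubling`, registered stub `stub_tamePrecompactness :
TamePrecompact zEns ∧ TamePrecompact tEns`.  THE SOFT MACHINE (`softMachine_limit`) applied to critical bond
percolation on `ℤ²` with the typed windowed collections of brick 10 (whole-plane interface loops of type `i` with
trace in `B̄(0, m + 3)`): measurable with finite range, compact sets of loops, TAUTOLOGICALLY faithful to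
`bondLoopConfig δ 0 ω = zEns.X δ ω`, and tight on the Aizenman–Burchard space AS SOON AS the whole-plane
interface loops of critical bond percolation obey the Aizenman–Burchard multiple-traversal estimate (H1)
(`softMachine_isTightLaws_bondWinColl_of_traversalBound`).  Hence
(`precompactLaw_measurable_zEns_of_traversalBound`, registered anchor) the EXACT `zEns` blocker of the lead's
census — T1m for `zEns`, measurable closeness events against both lattice ensembles at every mesh — follows from
that single named estimate, stated inline in the shape of the tree's site-`𝕋` theorem
`triSitePercolation_exists_loop_hasTraversals_le` (bond version: RSW on `ℤ²` + BK, Aizenman–Burchard 1999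
Appendix A; not in the tree).  Corollary: `precompactRegular_zEns_of_traversalBound_of_regularLimit`.
-/

noncomputable section

open MeasureTheory Set Filter Metric TopologicalSpace Function
open scoped Topology ENNReal NNReal unitInterval

namespace Summit.CriticalPhenomena.CardyFormulaZ2.Cruxes.NestingRigidity.PositiveConeWeightDoubling

open Literature.Probability.RandomPlanarGeometry Literature.Probability.Percolation
  Literature.Probability.LatticeModels
open Summit.CriticalPhenomena.CardyFormulaZ2.Cruxes.NestingRigidity.RingCloudTomography

/-- **THE SOFT MACHINE APPLIED TO BOND-`ℤ²` along a mesh sequence in `(0, 1]`, given (H1)**: a subsequence and a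
presentation `X` on `([0,1], Leb)` with measurable hitting events and
`d_CN((P_{1/2}, bondLoopConfig (δ (φ k)) 0), (Leb, X)) → 0`. -/
theorem SoftMachine.exists_subseq_limit_bondLoopConfig
    (hH1 : ∃ (k : ℕ) (K lam : ℝ), 0 ≤ K ∧ 2 < lam ∧ ∀ (M : Set (Sym2 (Site 2))) (δ : ℝ), δ ∈ Set.Ioc (0 : ℝ) 1 →
      ∀ (x : ℂ) (ρ R : ℝ), δ ≤ ρ → ρ < R → R ≤ 1 →
        bondPercolation (zdGraph 2) half {ω | ∃ γ : List MedialVertex, IsInterfaceLoop (ω ∩ M) γ ∧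
          (⟨Literature.Probability.LatticeModels.polyline ((γ ++ γ.take 1).map (medialPoint δ))⟩ : Curve ℂ).HasTraversals
            k x ρ R} ≤ ENNReal.ofReal (K * (ρ / R) ^ lam))
    (δs : ℕ → ℝ) (hδs : ∀ k, δs k ∈ Ioc (0 : ℝ) 1) :
    ∃ φ : ℕ → ℕ, StrictMono φ ∧ ∃ X : unitInterval → LoopConfig ℂ,
      (∀ (i : Fin 2) (Q : Set (UnbasedLoop ℂ)), IsClosed Q → MeasurableSet {s | ∃ u ∈ (X s).F i, u ∈ Q}) ∧
      Tendsto (fun k ↦ LoopConfig.cnLawEDist (bondPercolation (zdGraph 2) half) (bondLoopConfig (δs (φ k)) 0)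
        volume X) atTop (𝓝 0) := by
  haveI := standardBorelSpace_bondConfig
  set Ws : ℕ → ℕ → Fin 2 → BondConfig (Site 2) → LoopSpace ℂ := fun k m i ω ↦ Closeds.closure (loopCurve (δs k) 0 ''
    {γ : List MedialVertex | IsInterfaceLoop ω γ ∧ loopType γ = i ∧
      (loopCurve (δs k) 0 γ).range ⊆ closedBall (0 : ℂ) ((m : ℝ) + 3)}) with hWs
  have hpos : ∀ k, 0 < δs k := fun k ↦ (hδs k).1
  refine softMachine_limit (BondConfig (Site 2)) (bondPercolation (zdGraph 2) half)
    (fun k ↦ bondLoopConfig (δs k) 0) Ws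
    (fun k m i ↦ (SoftMachine.measurable_and_finite_range_bondWinColl (hpos k) ((m : ℝ) + 3) i).1)
    (fun k m i ↦ (SoftMachine.measurable_and_finite_range_bondWinColl (hpos k) ((m : ℝ) + 3) i).2)
    (fun k m i ω ↦ SoftMachine.isCompact_and_isLoop_bondWinColl (hpos k) _ i ω)
    (fun m i ε hε ↦ ?_) (fun k m i ω u hu hur ↦ ?_) (fun k m i ω c hc hcr ↦ ?_)
  · -- uniform tightness along the sequence, from brick 10 given (H1)
    exact SoftMachine.exists_isCompact_preimage_le_of_isTightLaws
      (softMachine_isTightLaws_bondWinColl_of_traversalBound hH1 ((m : ℝ) + 3) i) hδs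
      (fun k ↦ (SoftMachine.measurable_and_finite_range_bondWinColl (hpos k) ((m : ℝ) + 3) i).1) hε
  · -- faithfulness (tautological): a whole-plane loop inside `B(0, m + 2)` generates the window collection
    obtain ⟨γ, h, ht, rfl⟩ := mem_bondLoopConfig_iff.1 hu
    refine ⟨loopCurve (δs k) 0 γ, subset_closure ⟨γ, ⟨h, ht, ?_⟩, rfl⟩, isLoop_loopCurve _ 0 h.ne_nil, rfl⟩
    exact hur.trans (ball_subset_closedBall.trans (closedBall_subset_closedBall (by linarith)))
  · -- faithfulness: a member of the window collection is a whole-plane loop of the same type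
    have hc' : c ∈ (Ws k m i ω : Set (CurveClass ℂ)) := hc
    simp only [hWs] at hc'
    rw [SoftMachine.coe_bondWinColl (hpos k)] at hc'
    obtain ⟨γ, ⟨h, ht, -⟩, rfl⟩ := hc'
    exact ⟨isLoop_loopCurve _ 0 h.ne_nil, mem_bondLoopConfig_iff.2 ⟨γ, h, ht, rfl⟩⟩

/-- **Registered anchor** (`precompactLaw_measurable_zEns_of_traversalBound`, T1m for `zEns` given (H1)): IF the
whole-plane interface loops of critical bond percolation obey the Aizenman–Burchard multiple-traversal estimate,
THEN along every mesh sequence `δₖ → 0⁺` a subsequence of the laws of `zEns.X δₖ = bondLoopConfig δₖ 0` converges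
in DKKMO's coupling distance to a law presented on `([0,1], Leb)` whose closeness events against both lattice
ensembles are measurable at every mesh. -/
theorem precompactLaw_measurable_zEns_of_traversalBound :
    (∃ (k : ℕ) (K lam : ℝ), 0 ≤ K ∧ 2 < lam ∧ ∀ (M : Set (Sym2 (Site 2))) (δ : ℝ), δ ∈ Set.Ioc (0 : ℝ) 1 →
      ∀ (x : ℂ) (ρ R : ℝ), δ ≤ ρ → ρ < R → R ≤ 1 →
        bondPercolation (zdGraph 2) half {ω | ∃ γ : List MedialVertex, IsInterfaceLoop (ω ∩ M) γ ∧
          (⟨Literature.Probability.LatticeModels.polyline ((γ ++ γ.take 1).map (medialPoint δ))⟩ : Curve ℂ).HasTraversals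
            k x ρ R} ≤ ENNReal.ofReal (K * (ρ / R) ^ lam)) →
    ∀ δs : ℕ → ℝ, Tendsto δs atTop (𝓝[>] (0 : ℝ)) →
      ∃ φ : ℕ → ℕ, StrictMono φ ∧ ∃ X : unitInterval → LoopConfig ℂ,
        (∀ (δ ε : ℝ), ∀ E' ∈ latticeEnsembles,
          MeasurableSet {p : E'.Ω × unitInterval | LoopConfig.IsClose ε (E'.X δ p.1) (X p.2)}) ∧
        Tendsto (fun k : ℕ ↦ LoopConfig.cnLawEDist zEns.P (zEns.X (δs (φ k))) volume X) atTop (𝓝 0) := by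
  intro hH1 δs hδs
  obtain ⟨k₀, hk₀⟩ := eventually_atTop.1 (hδs.eventually (Ioc_mem_nhdsGT one_pos))
  obtain ⟨φ, hφ, X, hXhit, hconv⟩ :=
    SoftMachine.exists_subseq_limit_bondLoopConfig hH1 (fun k ↦ δs (k + k₀)) fun k ↦ hk₀ _ (Nat.le_add_left _ _)
  exact ⟨fun k ↦ φ k + k₀, hφ.add_const k₀, X, fun δ ε E' hE' ↦
    softMachine_measurableSet_isClose_latticeEnsembles_all E' hE' δ ε unitInterval X hXhit, hconv⟩

/-- **`PrecompactRegular zEns` from (H1) and the regular-limit statement** (T2m for `zEns`), via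
`precompactRegular_of_measurable_limits` (p129294). -/
theorem precompactRegular_zEns_of_traversalBound_of_regularLimit
    (hH1 : ∃ (k : ℕ) (K lam : ℝ), 0 ≤ K ∧ 2 < lam ∧ ∀ (M : Set (Sym2 (Site 2))) (δ : ℝ), δ ∈ Set.Ioc (0 : ℝ) 1 →
      ∀ (x : ℂ) (ρ R : ℝ), δ ≤ ρ → ρ < R → R ≤ 1 →
        bondPercolation (zdGraph 2) half {ω | ∃ γ : List MedialVertex, IsInterfaceLoop (ω ∩ M) γ ∧
          (⟨Literature.Probability.LatticeModels.polyline ((γ ++ γ.take 1).map (medialPoint δ))⟩ : Curve ℂ).HasTraversals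
            k x ρ R} ≤ ENNReal.ofReal (K * (ρ / R) ^ lam))
    (h₂ : ∀ (δs : ℕ → ℝ) (X : unitInterval → LoopConfig ℂ), Tendsto δs atTop (𝓝[>] (0 : ℝ)) →
      (∀ (δ ε : ℝ), MeasurableSet {p : zEns.Ω × unitInterval | LoopConfig.IsClose ε (zEns.X δ p.1) (X p.2)}) →
      Tendsto (fun k : ℕ ↦ LoopConfig.cnLawEDist zEns.P (zEns.X (δs k)) volume X) atTop (𝓝 0) →
      ∃ X' : unitInterval → LoopConfig ℂ, (∀ᵐ s : unitInterval, Regular (X' s)) ∧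
        Tendsto (fun k : ℕ ↦ LoopConfig.cnLawEDist zEns.P (zEns.X (δs k)) volume X') atTop (𝓝 0)) :
    PrecompactRegular zEns := by
  refine precompactRegular_of_measurable_limits zEns (fun δs hδs ↦ ?_) h₂
  obtain ⟨φ, hφ, X, hmeas, hconv⟩ := precompactLaw_measurable_zEns_of_traversalBound hH1 δs hδs
  exact ⟨φ, hφ, X, fun δ ε ↦ hmeas δ ε zEns zEns_mem, hconv⟩

end Summit.CriticalPhenomena.CardyFormulaZ2.Cruxes.NestingRigidity.PositiveConeWeightDoubling

end
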